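import Literature.Computability.QuantumComplexity.UniformSubstitution
import Literature.Computability.Complexity.TM2ToStackProgram
import HarnessLib

/-!
# Unary circuit descriptions of uniform families, and their flat stack programs

Input side of the executor machine of Nishimura–Ozawa 2002, Lemma 5.1 (`BQP ⊆ BQPQTM`: a
quantum Turing machine carrying out a polynomial-time uniform quantum circuit family), shared by
every design of that machine. The printed proof lets the machine "compute the code `c_r(K_n)`
of the circuit from `1ⁿ` by (a reversible simulation of) the polynomial-time uniformity machine"
and then reads the code gate by gate. A single-tape interpreter cannot cheaply use the BINARY wire
indices of the tree's description format (`QCircuit.sigmaEncode`: `boolPair (encodeNat n)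
(boolPair 1ᵐ (encList of tag :: boolPair (encodeNat (encode g)) (listBool encodeNat wires)))`),
so the description is first re-serialised, inside `FP`, with UNARY wire indices:

* `uwires N γ = (tag of γ, numeral of γ, wire indices of γ capped at N, i.e. unchanged for a
  gate on `≤ N` wires)` and `QCircuitFamily.unaryDesc F n = (ancillas n, (rawGates (circ n)).map
  (uwires (n + ancillas n)))`, coded by `UDesc.E = pairE unE (rawE UGate.E)`,
  `UGate.E (b, c, ws) = b :: pairE natE (rawE unE) (c, ws)` (ancilla count and wires in unary;
  tag bit and binary gate numeral exactly as in `QGate.encode`; faithful, oracle queries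
  included: `uwires_toRaw_injective`);
* `codeFP_uwires`, **`QCircuitFamily.codeFP_unaryDesc`**: for a uniform family the map
  `1ⁿ ↦ UDesc.E (unaryDesc F n)` is computed on codes in polynomial time (`CodeFP`, assembled from
  the combinators of `Complexity/CodeFP.lean`: the description function is in `FP` by
  `QCircuitFamily.descFn_mem_FP_of_isUniform`, the capped binary-to-unary conversion is
  `CodeFP.unOfNatMin`, mapped over the wires and the gates with the width as context);
* `unaryDesc_gate` / `uwires_toRaw_gate` (`…_oracle`): on a placed gate the unary raw gate is
  `(false, encode g, [e 0, …, e (k-1)])` (on an oracle query `(true, k, wires)`);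
* **`exists_aprog_of_codeFP`**: every map `g` computed on codes from the unary numerals is the
  output of a FLAT BINARY STACK PROGRAM (`AProg Bool (Fin K)` of `Complexity/SymbolPrograms.lean`:
  `push`/`pop`/`goto` on `K` binary registers): from `⟨0, 1ⁿ on inp⟩` the program reaches the
  halted address `|P|` with `code (g n)` alone on `out` after `t ≤ q(n)` steps, and stays there
  (`TM2Flat.exists_aprogFin_of_outputsWithin` applied to the `FP` machine, with the output-length
  polynomial of `exists_poly_length_le_of_mem_FP`); `QCircuitFamily.exists_aprog_unaryDesc` is the
  instance for the unary description of a uniform family — the program the executor machine runs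
  in its classical phase.

No named facts are introduced.

## References

* H. Nishimura, M. Ozawa, *Computational complexity of uniform quantum circuit families and
  quantum Turing machines*, Theoret. Comput. Sci. 276 (2002) 147–181 = arXiv:quant-ph/9906095
  [NishimuraOzawa2002]: §2 (codes of circuits), Lemma 5.1 and its proof (the machine computes the
  code of `K_n` from `1ⁿ`, then carries out the gates).
* S. Arora, B. Barak, *Computational Complexity: A Modern Approach*, CUP 2009, §1.3 (closure of
  polynomial time; Claim 1.5, recoding alphabets), §6.1–6.2 (descriptions of circuits, P-uniform
  families) [AroraBarak2009].
-/

namespace Literature.Computability.QuantumComplexity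

open _root_.Computability Complexity Cryptography CodeFP

/-! ### Unary raw gates and descriptions -/

/-- A **unary raw gate**: tag bit (`true` for an oracle query, as in `RawGate`), numeral (code
of the gate symbol, resp. number of query wires) and wire indices (to be coded in unary). [cite: NishimuraOzawa2002, §2 (codes of quantum gates)] -/
abbrev UGate : Type := Bool × (ℕ × List ℕ)

/-- The code of a unary raw gate: the tag bit, then the pair of the binary numeral and the raw
list of UNARY wire indices (mirroring `RawGate.E`, whose wire list is headed and binary). [cite: AroraBarak2009, §6.1] -/
abbrev UGate.E : UGate → List Bool := fun γ => γ.1 :: pairE natE (rawE unE) γ.2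

/-- A **unary description**: ancilla count and unary raw gates. [cite: NishimuraOzawa2002, §2] -/
abbrev UDesc : Type := ℕ × List UGate

/-- The code of a unary description: unary ancilla count, raw list of unary raw gate codes. [cite: AroraBarak2009, §6.1] -/
abbrev UDesc.E : UDesc → List Bool := pairE unE (rawE UGate.E)

/-- The unary raw gate of a raw gate on an `N`-wire register: the tag and the numeral unchanged,
the wire indices capped at `N` (a no-op for genuine wire indices `< N`; the cap makes the
binary-to-unary conversion polynomial). The re-serialisation is faithful (injective on the raw
gates of circuits on `≤ N` wires, oracle queries included). [cite: AroraBarak2009, §1.3] -/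
def uwires (N : ℕ) (γ : RawGate) : UGate := (γ.1, γ.2.1, γ.2.2.map fun w => min w N)

/-- **The unary description of the `n`-th circuit of a family.** [cite: NishimuraOzawa2002, Lemma 5.1 (proof: the code of K_n)] -/
def _root_.Literature.Computability.Cryptography.QCircuitFamily.unaryDesc {G : QGateSet} [Encodable G.Op]
    (F : QCircuitFamily G) (n : ℕ) : UDesc :=
  (F.ancillas n, (F.circ n).rawGates.map (uwires (n + F.ancillas n)))

section Values

variable {G : QGateSet} [Encodable G.Op]

/-- On a placed gate of an `N`-wire circuit the unary raw gate is `(encode g, [e 0, …])`. [folklore] -/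
theorem uwires_toRaw_gate {N M : ℕ} (hNM : N ≤ M) (g : G.Op) (e : Fin (G.arity g) ↪ Fin N) :
    uwires M (QGate.toRaw (QGate.gate g e : QGate G N)) = (false, Encodable.encode g, List.ofFn fun i => (e i : ℕ)) := by
  simp only [uwires, QGate.toRaw, List.map_ofFn, Prod.mk.injEq, true_and]
  refine List.ofFn_inj.2 (funext fun i => ?_)
  simp only [Function.comp_apply]
  have := (e i).isLt
  omega

/-- On an oracle query the unary raw gate is `(k, [e 0, …])`. [folklore] -/
theorem uwires_toRaw_oracle {N M : ℕ} (hNM : N ≤ M) (k : ℕ) (e : Fin (k + 1) ↪ Fin N) :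
    uwires M (QGate.toRaw (QGate.oracle k e : QGate G N)) = (true, k, List.ofFn fun i => (e i : ℕ)) := by
  simp only [uwires, QGate.toRaw, List.map_ofFn, Prod.mk.injEq, true_and]
  refine List.ofFn_inj.2 (funext fun i => ?_)
  simp only [Function.comp_apply]
  have := (e i).isLt
  omega

/-- The ancilla component of the unary description. [folklore] -/
@[simp] theorem unaryDesc_fst (F : QCircuitFamily G) (n : ℕ) : (F.unaryDesc n).1 = F.ancillas n := rfl

/-- The gate component of the unary description. [folklore] -/
theorem unaryDesc_snd (F : QCircuitFamily G) (n : ℕ) :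
    (F.unaryDesc n).2 = (F.circ n).gates.map (fun γ => uwires (n + F.ancillas n) γ.toRaw) := by
  simp [QCircuitFamily.unaryDesc, QCircuit.rawGates, List.map_map, Function.comp_def]

/-- The number of unary raw gates is the size of the circuit. [folklore] -/
@[simp] theorem length_unaryDesc_snd (F : QCircuitFamily G) (n : ℕ) : (F.unaryDesc n).2.length = (F.circ n).size := by
  simp [unaryDesc_snd, QCircuit.size]

/-- **The unary description lists the placed gates**: where the `i`-th gate of the circuit is a
placed (non-oracle) gate `gate g e`, the `i`-th unary raw gate is `(false, encode g, wires of e)`. [cite: NishimuraOzawa2002, §2] -/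
theorem unaryDesc_gate (F : QCircuitFamily G) (n : ℕ) {i : ℕ} (hi : i < (F.circ n).gates.length)
    {g : G.Op} {e : Fin (G.arity g) ↪ Fin (n + F.ancillas n)} (h : (F.circ n).gates[i] = QGate.gate g e) :
    (F.unaryDesc n).2[i]'(by simpa [QCircuit.size] using hi) = (false, Encodable.encode g, List.ofFn fun j => (e j : ℕ)) := by
  simp only [unaryDesc_snd, List.getElem_map, h]
  exact uwires_toRaw_gate le_rfl g e

/-- Where the `i`-th gate is an oracle query the `i`-th unary raw gate is `(true, k, wires of e)`. [cite: NishimuraOzawa2002, §2] -/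
theorem unaryDesc_oracle (F : QCircuitFamily G) (n : ℕ) {i : ℕ} (hi : i < (F.circ n).gates.length)
    {k : ℕ} {e : Fin (k + 1) ↪ Fin (n + F.ancillas n)} (h : (F.circ n).gates[i] = QGate.oracle k e) :
    (F.unaryDesc n).2[i]'(by simpa [QCircuit.size] using hi) = (true, k, List.ofFn fun j => (e j : ℕ)) := by
  simp only [unaryDesc_snd, List.getElem_map, h]
  exact uwires_toRaw_oracle le_rfl k e

/-- On the raw gate of ANY gate of an `N`-wire circuit the cap is a no-op: `uwires M` fixes it. [folklore] -/
theorem uwires_toRaw_eq {N M : ℕ} (hNM : N ≤ M) (γ : QGate G N) : uwires M γ.toRaw = γ.toRaw := by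
  cases γ with
  | gate g e => rw [uwires_toRaw_gate hNM]; rfl
  | oracle k e => rw [uwires_toRaw_oracle hNM]; rfl

/-- `QGate.toRaw` is injective (its code is the injective gate code). [folklore] -/
theorem toRaw_injective {N : ℕ} : Function.Injective (QGate.toRaw (G := G) (n := N)) := fun γ γ' h =>
  QCircuit.encode_injective_gate (G := G) (n := N)
    (show γ.encode = γ'.encode by rw [QGate.encode_eq_E_toRaw, QGate.encode_eq_E_toRaw, h])

/-- **The unary re-serialisation is faithful**: `uwires M ∘ toRaw` is injective on the gates of a
circuit on `N ≤ M` wires, oracle queries included. [folklore] -/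
theorem uwires_toRaw_injective {N M : ℕ} (hNM : N ≤ M) :
    Function.Injective fun γ : QGate G N => uwires M γ.toRaw := fun γ γ' h =>
  toRaw_injective (by simpa only [uwires_toRaw_eq hNM] using h)

end Values

/-! ### The unary description is computed on codes -/

/-- `uwires` is computed on codes, the width in unary as context. [cite: AroraBarak2009, §1.3] -/
theorem codeFP_uwires : CodeFP (pairE unE RawGate.E) UGate.E (fun p => uwires p.1 p.2) := by
  have htag : CodeFP (pairE unE RawGate.E) bitE (fun p => p.2.1) := RawGate.codeFP_tag.comp (snd _ _)
  have hbody : CodeFP (pairE unE RawGate.E) (pairE natE (listE natE)) (fun p => p.2.2) :=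
    RawGate.codeFP_body.comp (snd _ _)
  have hws : CodeFP (pairE unE RawGate.E) (rawE natE) (fun p => p.2.2.2) :=
    (rawOfList natE).comp hbody.snd'
  have hmap : CodeFP (pairE unE (rawE natE)) (rawE unE) (fun p => p.2.map fun w => min w p.1) :=
    map (σ := ℕ) (eσ := unE) (g := fun q : ℕ × ℕ => min q.2 q.1) unOfNatMin
  have hw : CodeFP (pairE unE RawGate.E) (rawE unE) (fun p => p.2.2.2.map fun w => min w p.1) :=
    hmap.comp ((fst _ _).pair hws)
  have hnew : CodeFP (pairE unE RawGate.E) (pairE bitE (pairE natE (rawE unE)))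
      (fun p => (p.2.1, p.2.2.1, p.2.2.2.map fun w => min w p.1)) := htag.pair (hbody.fst'.pair hw)
  -- assembling the tagged code `b :: body` from `pairE bitE body` (as for `RawGate.codeFP_mk`)
  have hmk : CodeFP (pairE bitE (pairE natE (rawE unE))) UGate.E (fun p : UGate => p) := by
    refine ⟨iteFn (HashBricks.headBitFn ∘ Brick.fstF) (List.cons true ∘ Brick.sndF)
        (List.cons false ∘ Brick.sndF),
      iteFn_mem_FP (comp_mem_FP HashBricks.headBitFn_mem_FP Brick.fstF_mem_FP)
        (comp_mem_FP (cons_mem_FP true) Brick.sndF_mem_FP)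
        (comp_mem_FP (cons_mem_FP false) Brick.sndF_mem_FP), fun p => ?_⟩
    obtain ⟨b, c, ws⟩ := p
    have hc : (HashBricks.headBitFn ∘ Brick.fstF) (pairE bitE (pairE natE (rawE unE)) (b, c, ws)) = [b] := by
      simp [bitE]
    rw [iteFn_apply hc]
    cases b <;> simp [UGate.E]
  exact (hmk.comp hnew).congr fun p => rfl

/-- The raw description of a uniform family is computed on codes from the unary input length. [cite: AroraBarak2009, §6.2 (Remark 6.7)] -/
theorem codeFP_rawDesc {G : QGateSet} [Encodable G.Op] {F : QCircuitFamily G} (hU : F.IsUniform) :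
    CodeFP unE RawDesc.E F.rawDesc :=
  of_fn F.descFn (QCircuitFamily.descFn_mem_FP_of_isUniform hU) fun n => by
    rw [QCircuitFamily.descFn_eq_E_rawDesc, show (unE n).length = n from length_unE n]

/-- **The unary description of a uniform family is computed on codes in polynomial time** from
the unary input length. [cite: NishimuraOzawa2002, Lemma 5.1 (proof)] -/
theorem _root_.Literature.Computability.Cryptography.QCircuitFamily.codeFP_unaryDesc {G : QGateSet} [Encodable G.Op]
    {F : QCircuitFamily G} (hU : F.IsUniform) : CodeFP unE UDesc.E F.unaryDesc := by
  -- context: `(n, rawDesc F n)`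
  have hctx : CodeFP unE (pairE unE RawDesc.E) (fun n => (n, F.rawDesc n)) := (CodeFP.id unE).pair (codeFP_rawDesc hU)
  -- ancillas `m` (unary in the raw description) and the width `n + m`
  have hm : CodeFP (pairE unE RawDesc.E) unE (fun p => p.2.2.1) := ((snd _ _).snd').fst'
  have hN : CodeFP (pairE unE RawDesc.E) unE (fun p => p.1 + p.2.2.1) := unAdd.comp ((fst _ _).pair hm)
  have hgs : CodeFP (pairE unE RawDesc.E) (rawE RawGate.E) (fun p => p.2.2.2) := ((snd _ _).snd').snd'
  have hmap : CodeFP (pairE unE (rawE RawGate.E)) (rawE UGate.E) (fun p => p.2.map fun γ => uwires p.1 γ) :=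
    map (σ := ℕ) (eσ := unE) codeFP_uwires
  have hall : CodeFP (pairE unE RawDesc.E) UDesc.E (fun p => (p.2.2.1, p.2.2.2.map fun γ => uwires (p.1 + p.2.2.1) γ)) :=
    hm.pair (hmap.comp (hN.pair hgs))
  exact (hall.comp hctx).congr fun n => rfl

/-! ### From codes to flat stack programs -/

/-- **A map computed on codes from the unary numerals is the output of a flat binary stack
program**: for `g` with `CodeFP unE eβ g` there are a program `P : AProg Bool (Fin K)`, registers
`inp`, `out` and a polynomial `q` such that, for every `n`, `|code (g n)| ≤ q(n)` and the run from
`⟨0, 1ⁿ on inp⟩` reaches `⟨|P|, code (g n) on out⟩` (all other registers empty) after some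
`t ≤ q(n)` steps. [cite: AroraBarak2009, §1.3 (Claim 1.5) and §1.4] -/
theorem exists_aprog_of_codeFP {β : Type} {eβ : β → List Bool} {g : ℕ → β} (h : CodeFP unE eβ g) :
    ∃ (K : ℕ) (P : AProg Bool (Fin K)) (inp out : Fin K) (q : Polynomial ℕ), ∀ n : ℕ,
      (eβ (g n)).length ≤ q.eval n ∧ ∃ t ≤ q.eval n,
        P.step^[t] ⟨0, AStore.single inp (unE n)⟩ = ⟨P.length, AStore.single out (eβ (g n))⟩ := by
  obtain ⟨f, hf, hfg⟩ := h
  obtain ⟨s, hs⟩ := exists_poly_length_le_of_mem_FP hf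
  obtain ⟨p, M, hM⟩ := hf
  obtain ⟨K, P, inp, out, e, hP⟩ := TM2Flat.exists_aprogFin_of_outputsWithin M
  refine ⟨K, P, inp, out, Polynomial.C e * (p + Polynomial.X + s) + Polynomial.C e + s, fun n => ⟨?_, ?_⟩⟩
  · have := hs (unE n)
    rw [length_unE, hfg] at this
    simp only [Polynomial.eval_add, Polynomial.eval_mul, Polynomial.eval_C, Polynomial.eval_X]
    omega
  · have hrun : M.OutputsWithin (unE n) (eβ (g n)) (p.eval n) := by
      have := hM (unE n)
      simp only [id] at this
      rwa [hfg, length_unE] at this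
    obtain ⟨t, ht, hex⟩ := hP (unE n) (eβ (g n)) (p.eval n) hrun
    refine ⟨t, ?_, hex⟩
    have hlen : (eβ (g n)).length ≤ s.eval n := by
      have := hs (unE n); rwa [length_unE, hfg] at this
    rw [length_unE] at ht
    simp only [Polynomial.eval_add, Polynomial.eval_mul, Polynomial.eval_C, Polynomial.eval_X]
    nlinarith

/-- Past the halting step the flat program stays put: the run may be read off at ANY later time
(`AProg.iterate_step_of_le`). [folklore] -/
theorem aprog_iterate_of_halt {K : ℕ} (P : AProg Bool (Fin K)) {c : ACfg Bool (Fin K)} {R : AStore Bool (Fin K)}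
    {t T : ℕ} (h : P.step^[t] c = ⟨P.length, R⟩) (hT : t ≤ T) : P.step^[T] c = ⟨P.length, R⟩ := by
  obtain ⟨d, rfl⟩ := Nat.exists_eq_add_of_le hT
  rw [Nat.add_comm, Function.iterate_add_apply, h, P.iterate_step_of_le le_rfl]

/-- **The classical phase of the executor**: for a uniform family there is a flat binary stack
program which, from `1ⁿ` on its input register, halts with the code of the unary description of
the `n`-th circuit alone on its output register, within `q(n)` steps, `q` a polynomial also
bounding the length of that code; at every time `T ≥ q(n)` the configuration is the halted one. [cite: NishimuraOzawa2002, Lemma 5.1 (proof: compute the code of K_n from 1ⁿ)] -/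
theorem _root_.Literature.Computability.Cryptography.QCircuitFamily.exists_aprog_unaryDesc {G : QGateSet}
    [Encodable G.Op] {F : QCircuitFamily G} (hU : F.IsUniform) :
    ∃ (K : ℕ) (P : AProg Bool (Fin K)) (inp out : Fin K) (q : Polynomial ℕ), ∀ n : ℕ,
      (UDesc.E (F.unaryDesc n)).length ≤ q.eval n ∧
      ∀ T, q.eval n ≤ T →
        P.step^[T] ⟨0, AStore.single inp (unE n)⟩ = ⟨P.length, AStore.single out (UDesc.E (F.unaryDesc n))⟩ := by
  obtain ⟨K, P, inp, out, q, h⟩ := exists_aprog_of_codeFP (QCircuitFamily.codeFP_unaryDesc hU)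
  refine ⟨K, P, inp, out, q, fun n => ⟨(h n).1, fun T hT => ?_⟩⟩
  obtain ⟨t, ht, hex⟩ := (h n).2
  exact aprog_iterate_of_halt P hex (ht.trans hT)

end Literature.Computability.QuantumComplexity
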